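import Literature.MathematicalPhysics.QuantumFieldTheory.Balaban1983to89.Node00.CarriersB8CubePrint
import Literature.MathematicalPhysics.QuantumFieldTheory.Balaban1983to89.B9Eq335AxialCriterion
import Literature.MathematicalPhysics.QuantumFieldTheory.Balaban1983to89.B8Ineq159FlatCubeMemberPerCube

/-!
# `Balaban1983to89.B8Prop6Reg335Cube` — [Balaban1985RegularSpaces] PROPOSITION 6's PRINTED APPLICATION, PER CUBE: the conclusion
# (1.135)–(1.136) of Proposition 6 at one print cube `□` (NODE 00's `Node00.GaugedBoundB8 L η U₀ c r`) IS «the regularity condition (3.35) in [4]»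
# of the background `U₀` on every set of sites `Q ⊆ □` at the scale `Lᵏη` of `□`, in r05's ∕ r06's letters
# (`B9Eq335RegularityClasses.Reg335Cube (shiftT d) (byDir U₀) η Q (Lᵏη) C`, any `C > r`); and the index-`0` cubes, where (3.35) follows from
# the plaquette smallness alone in the complete axial gauge (print, p. 98, SUBSUMES this case in the general one: «we have to admit the value k = 0. In this case the reasoning is much simpler and will be covered by our analysis of a general case, so we can assume that k ≥ 1»;
# NODE 00's `CubeB8` requires `1 ≤ k`, so the index-0 class cubes are served here by an elementary argument of this seat)

statement-level skeleton of published theorems with citation tags; proofs where landed; nothing here is a claim about the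
Yang–Mills mass gap

PDF held: `paper:balaban1985-cmp99-regular-spaces-gauge-fixing`, p. 98 (p0024: «Now let us take a cube □ ⊂ Ω₀ for which we want to prove the condition
(3.35) … we have to admit the value k = 0. In this case the reasoning is much simpler and will be covered by our analysis of a general case, so we can assume that
k ≥ 1»), p. 99 (p0025: Proposition 6, (1.134)–(1.138), «The configuration U₁
in a neighborhood of □ is obtained from U₀ by a gauge transformation, hence for α₀ sufficiently small we have proved the regularity condition (3.35). This
implies that we can drop out this condition from the assumption (1.33)»), p. 82 ((1.33): «U₀ satisfies the regularity condition (3.35) in [4]. … We will see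
later that this condition is a consequence of the first one in (1.33), so eventually we will drop it out of the assumptions»); [4] =
[Balaban1985BackgroundPropagators] p. 396 ((3.35): «for an arbitrary cube □ of the described above class, and for a configuration U there exists a gauge
transformation u on □ such that U^u = e^{iηA}. and if the index of □ is j, then |A| < O(1)Mα₀(Lʲη)⁻¹, |∇^ηA| < O(1)Mα₀(Lʲη)⁻² on □»).  Read on the held
text layer by this seat (2026-08-28).

WHY THIS FILE (cell `pub-ymgap`, YM-PLAN Track A node N05, FAN-OUT §N05 row s3b «Proposition 6 at the concrete cube family», seat `pub-ymgap-dag-n05-e`;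
count-neutral).  [B8] Proposition 6 AS PRINTED is in the tree UNCONDITIONALLY on print's p. 98 cube class for `d ≥ 2`, odd `L ≥ 5`
(`B8Prop6PrintedZdCubPGamma.prop6Printed_zdCubP_γ_holds`: `B8.Prop6Printed d L B₁ c₁ (zdCubP 𝔸 L ρ₀ ∘ f)`, i.e. `GaugedBoundB8` at every print cube for
every unitary `U₀ ∈ 𝔄_k({Ω_j}, α₀)` above threshold).  Its PRINTED PURPOSE — the second clause of (1.33), (3.35) of [4] for the background — enters the
tree's J-N06→N05 junction as a HYPOTHESIS: dag-n06-b's binder `B9SupplySockB9P3ZdAt.Prop6At bg L mem ιCfg c35 c₆ K₆ M i m` («(3.35) for U₀ by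
Proposition 6», the step `hreg := hP6 …` of `sockB9P3P_at_univ`), displayed in the N16 ∕ N27 ∕ K3-spine files and in N05's univ knits, and at
dag-n06-e's frame of record `B9SupplySockB9P3ZdFrame.bgZd` (whose `Reg335` field is the GENUINE class `B8Eq133Hypotheses.Reg335Zd` on the p. 396 cube
class `cubeClass396Zd`) it is nowhere discharged (the A6 witness `B9SupplySockB9P3ZdUnivWitness.binders_inhabited_univ_zero` inhabits it at a frame with
«`Reg335 := ⊤`»; `B9Eq335AxialCriterion.reg335Zd_of_plaq_radii` needs an EXTRA plaquette-gradient radius that `𝔄_k` does not carry and says so).  THIS FILE is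
the per-cube half of that discharge: the LETTER BRIDGE from NODE 00's Proposition-6 conclusion to r05's (3.35)-clause, and the elementary index-`0` case.
The assembly over the p. 396 cube class at the all-torus members (inscription of every class cube into a print cube; `Prop6At` at `bgZd`) is the companion
`B8Prop6Reg335ZdAllTorus`.

WHAT IS PROVED (kernel-checked, 0 sorry, 0 def; `𝔸` a C⋆-algebra for §1, a complete normed `ℂ`-algebra with `‖1‖ = 1` for §2).
* §0 `add_e_mem_cube_top` — bookkeeping: a bond starting in `□ = box L a M k` ends in `□_k` (the margin `R₁M₁Lᵏ ≥ 1` of p. 98); `bdd_sideTouches_cubeFam` —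
  the p. 86 weighted family over the sides touching the `□_j`, `j ≤ k`, is bounded (finitely many bonds — dag-n05-w3's `sideTouches_pairs_finite`), so NODE 00's
  `msup (−2) ≤ r` clause of (1.136)₂ reads pointwise.
* §1 ★ `reg335Cube_of_gaugedBoundB8` — **THE BRIDGE**: `GaugedBoundB8 L η U₀ c r` (d ≥ 2, L ≥ 2, η > 0), `Q ⊆ box L c.a c.M c.k`, `r < C` ⟹
  `Reg335Cube (shiftT d) (byDir U₀) η Q (Lᵏη) C` with `k = c.k`: the gauge is `u := (v⁻¹u′)⁻¹` of (1.135) (NODE 00's `AgreeOn` clause: `U₀^{u} = U₁ = U₀″^{u′⁻¹}` on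
  the bonds of `□̃ ⊇ □_k ⊋ □`), unitary hence of r06's unit type; the field is `A := (1∕iη) log U₁` (`B8Eq138LandauZd.logCfg`), and `U^u = e^{iηA}`
  (`B9Eq39Adjoint.fluct`) is NODE 00's `U₁ = cfgExp η (logCfg η U₁)` on the sides touching `□_k`; `|A| ≤ r(Lᵏη)⁻¹ < C(Lᵏη)⁻¹` is (1.136)₁ there; and
  `|∇^ηA| ≤ r(Lᵏη)⁻² < C(Lᵏη)⁻²` is the `j = k` member of the `msup (−2)` clause (1.136)₂ of the masked exponent `mlogCfg` (= `logCfg` on those sides,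
  n05-a's `mlogCfg_of_sideTouches`), r06's flat `η⁻¹·covD shiftT 1` being n05-a's `covDerivFwd η 1`.  Pure bookkeeping; print: «Of course (1.127) implies
  the regularity condition (3.35)» (p. 98) — (1.136) is (1.127)'s form at `□`.
* §2 ★ `reg335Cube_index_zero` — **THE INDEX-0 CUBES** (print p. 98 subsumes `k = 0` in the general case — «we have to admit the value k = 0. In this case the reasoning is much simpler and will be covered by our analysis of a general case, so we can assume that k ≥ 1» — whereas NODE 00's
  `CubeB8` carries `1 ≤ k`; so this seat serves the index-0 class cubes by its OWN elementary argument [folklore], not by a printed step): a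
  `U1`-valued `V` whose plaquette variables are within `α` of `1` everywhere satisfies the (3.35)-clause at scale `L⁰η = η ≤ 1` on every set of `ℓ¹`-radius `R`
  about a point `y`, with any constant `C > 4(R + 1)α`, provided `(R + 1)α ≤ ½` (any `η > 0`): in the complete axial gauge `axialFn V y` of [Balaban1985Averaging] p. 24
  (`B7Prop1Explicit.axial_bond_bound`: `|V₀(b) − 1| ≤ |b₋ − y|₁α`), `A := (iη)⁻¹ log V₀` has `|A| ≤ 2Rα·η⁻¹` and — the scale being `η` itself — the TRIVIAL
  difference bound `|∇^ηA| ≤ η⁻¹(|A(b + e_κ)| + |A(b)|)·(Lipschitz 2) ≤ 4(R+1)α·η⁻²` already has the printed shape; no gradient radius and no Theorem 4 needed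
  at index 0 (the `η`-uniformity that fails for `j ≥ 1` in `reg335Zd_of_plaq_radii`'s remark is not asked at `j = 0`).  Mechanism = dag-n16-b's
  `reg335Zd_of_plaq_radii` §6 with the gradient radius replaced by the triangle inequality; credited.
HONEST SCOPE.  (a) Bookkeeping over landed objects: nothing of [Balaban1985RegularSpaces] Thm 4 ∕ Prop. 6 or of [4] is PROVED here — §1 CONSUMES
`GaugedBoundB8` (supplied unconditionally by `prop6Printed_zdCubP_γ_holds` on print's class), §2 is lattice-gauge kinematics [folklore].  (b) The constant is any
`C > r`; (3.35)'s strict `<` forces the slack.  (c) (3.36) (second differences) is NOT produced (no binder of the junction reads `Reg336`; `B9.Thm33Printed` :229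
reads `Reg335` only).  (d) `d ≥ 2` is used only to name a plaquette through a bond (p. 77 touching convention).  Count-neutral; N05 ∕ N06 NOT discharged; one
finite lattice programme at fixed spacing, Bałaban AS PRINTED; nothing continuum ∕ ℝ⁴ ∕ OS ∕ mass-gap ∕ Clay.  No `sorry`, no `axiom`, no definition, no
`instance`, no `notation`.  Unit `pub-ymgap-dag-n05-e` (g14), 2026-08-28.  v1.1 (same day): DOCSTRING-ONLY edition — the p. 98 `k = 0` sentence quoted in full
(referee pub-ymgap-dag-ref-E READ-21 NIT-1: print subsumes `k = 0` in the general case; §2 is this seat's elementary argument); declarations unchanged.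
-/

noncomputable section

open NormedSpace
open Complex (I)

namespace Literature.MathematicalPhysics.QuantumFieldTheory.Balaban1983to89.B8Prop6Reg335Cube

open B7Prop1Explicit B7Prop2Explicit B7Prop1Local
open B7Eq78Linearization (conjR)
open B8Ineq130 (tlo thi)
open B8Ineq132 (InAk covDerivFwd BondTouches)
open B8Eq131Cubes (box cube tcube bLo bHi tLo tHi cube_eq margin_top box_subset_cube_top cube_subset_tcube)
open B8Eq131CubesAdmissible (cubeFam cubeFam_false_of_le)
open B8Eq140Level (SideTouches sideTouches_of_bondTouches)
open B8Eq138LandauZd (logCfg)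
open B8Eq184Proof (cfgExp)
open B8LeafModelZd3 (mlogCfg mlogCfg_of_sideTouches)
open B8ScaledSupNorm (msup Bdd weight norm_le_of_msup_le)
open B8Eq133Hypotheses (Reg335Zd shiftT byDir byDir_apply shiftT_apply gaugeTr_byDir)
open B9Eq335RegularityClasses (Reg335Cube)
open B9Eq39Adjoint (R covD fluct)
open B9Eq3117Current (gaugeTr)
open LatticeNorms (scaleLen)
open MatrixLog (mlog exp_mlog norm_mlog_le_two_mul)
open B8Ineq159FlatCubeMemberPerCube (sideTouches_pairs_finite)
open Node00 (CubeB8 GaugedBoundB8)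

variable {d : ℕ}

/-! ## §0 Bookkeeping: the collar of `□` inside `□_k`, and boundedness of the p. 86 family over the sides touching the `□_j` -/

/-- A bond starting in `□ = [Lᵏa, Lᵏ(a + M) − 1]ᵈ` ends in `□_k` (margin `R₁M₁Lᵏ ≥ 1` fine sites: «a distance between boundaries of these cubes is equal to
R₁M₁Lʲη», p. 98). [cite: Balaban1985RegularSpaces, p.98 («□_k, □̃, such that □_j ⊃ □_{j+1}»)] -/
theorem add_e_mem_cube_top {L : ℕ} (hL : 1 ≤ L) {a : B7Prop1Explicit.Site d} {M ρ k : ℕ} (hρ : 1 ≤ ρ) {z : B7Prop1Explicit.Site d} (hz : z ∈ box L a M k) (κ : Fin d) :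
    z + e κ ∈ cube L a M ρ k k := by
  rw [cube_eq le_rfl, margin_top]
  have hm : (1 : ℤ) ≤ ((ρ * L ^ k : ℕ) : ℤ) := by
    have h1 : 1 ≤ ρ * L ^ k := Nat.one_le_iff_ne_zero.mpr (Nat.mul_ne_zero (by omega) (pow_ne_zero _ (by omega)))
    exact_mod_cast h1
  have hz' : InBox (bLo L a k 0) (bHi L a M k 0) z := hz
  intro i
  obtain ⟨h1, h2⟩ := hz' i
  simp only [bLo, bHi, Nat.cast_zero, sub_zero, add_zero] at h1 h2
  have hei : (e κ : B7Prop1Explicit.Site d) i = if i = κ then 1 else 0 := by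
    simp only [e, Pi.single_apply]
  simp only [bLo, bHi, Pi.add_apply, hei]
  constructor
  · split_ifs <;> linarith
  · split_ifs <;> linarith

/-- **The p. 86 weighted family over the sides touching the `□_j`, `j ≤ k`, is bounded** (finitely many such bonds — dag-n05-w3's `sideTouches_pairs_finite`),
so a bound `msup (…) ≤ r` on it reads pointwise (`B8ScaledSupNorm.norm_le_of_msup_le`). [cite: Balaban1985RegularSpaces, p.86 (definition after (1.55)), (1.131) p.99] -/
theorem bdd_sideTouches_cubeFam {E : Type*} [SeminormedAddCommGroup E] (L : ℕ) (a : B7Prop1Explicit.Site d) (M ρ k : ℕ) (η α : ℝ)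
    (F : Fin d × Fin d × B7Prop1Explicit.Site d → E) :
    Bdd L k η α (fun j (t : Fin d × Fin d × B7Prop1Explicit.Site d) => SideTouches (cubeFam false L a M ρ k j) t.2.2 t.2.1) F := by
  classical
  set S : Set (ℕ × (Fin d × Fin d × B7Prop1Explicit.Site d)) :=
    {p | p.1 ≤ k ∧ SideTouches (cubeFam false L a M ρ k p.1) p.2.2.2 p.2.2.1} with hS_def
  have hS : S.Finite := by
    have hT := sideTouches_pairs_finite L a M ρ (le_refl k)
    refine ((hT.prod (Set.finite_univ (α := Fin d))).image
      (fun x : (ℕ × (B7Prop1Explicit.Site d × Fin d)) × Fin d => (x.1.1, (x.2, x.1.2.2, x.1.2.1)))).subset ?_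
    rintro ⟨j, κ, ν, z⟩ ⟨hj, hs⟩
    exact ⟨((j, (z, ν)), κ), ⟨⟨hj, hs⟩, Set.mem_univ _⟩, rfl⟩
  obtain ⟨C, hC⟩ := (hS.image fun p : ℕ × (Fin d × Fin d × B7Prop1Explicit.Site d) => weight L η α p.1 * ‖F p.2‖).bddAbove
  exact ⟨C, fun j hj t ht => hC ⟨(j, t), ⟨hj, ht⟩, rfl⟩⟩

/-! ## §1 The bridge: NODE 00's (1.135)–(1.136) at a print cube ⟹ r05's (3.35)-clause on `□` at scale `Lᵏη` -/

section Bridge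

variable {𝔸 : Type*} [CStarAlgebra 𝔸] [Nontrivial 𝔸]

/-- ★ **PROPOSITION 6's CONCLUSION AT A CUBE IS (3.35) ON `□` AT ITS SCALE** (print p. 98 «Of course (1.127) implies the regularity condition (3.35)»,
p. 99 «The configuration U₁ in a neighborhood of □ is obtained from U₀ by a gauge transformation, hence … we have proved the regularity condition (3.35)»):
for `d ≥ 2`, `L ≥ 2`, `η > 0`, a cube `c` of NODE 00's Proposition-6 carrier and `GaugedBoundB8 L η U₀ c r` ((1.135)–(1.138) with the number `r`), every set
of sites `Q ⊆ □ = box L c.a c.M c.k` carries r06's (3.35)-clause `Reg335Cube (shiftT d) (byDir U₀) η Q (Lᵏη) C` for every `C > r`: gauge `u = (v⁻¹u′)⁻¹`,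
field `A = (1∕iη) log U₁`, `U₀^u = e^{iηA}`, `|A| < C(Lᵏη)⁻¹`, `|∇^ηA| < C(Lᵏη)⁻²` on `□`.  Bookkeeping over NODE 00's clauses (`AgreeOn` on `□̃`, the
exponential form and (1.136)₁ on the sides touching `□_k`, the `msup (−2)` member of (1.136)₂).
[cite: Balaban1985RegularSpaces, Prop. 6 (1.135)–(1.136) p.99, p.98, (1.33) p.82; Balaban1985BackgroundPropagators, (3.35) p.396, (3.28) p.395] -/
theorem reg335Cube_of_gaugedBoundB8 (hd2 : 2 ≤ d) {L K : ℕ} (hL : 2 ≤ L) {Ω : ℕ → Set (B7Prop1Explicit.Site d)} {η : ℝ} (hη : 0 < η)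
    {U₀ : B7Prop1Explicit.Site d → Fin d → 𝔸ˣ} (c : CubeB8 d L K Ω) {r C : ℝ} (hrC : r < C)
    (h : GaugedBoundB8 L η U₀ c r) {Q : Set (B7Prop1Explicit.Site d)} (hQ : Q ⊆ box L c.a c.M c.k) :
    Reg335Cube (shiftT d) (byDir U₀) η Q (scaleLen (L : ℝ) η c.k) C := by
  classical
  obtain ⟨u, -, -, -, -, h162, hw, h135, h136₂, -, -, -⟩ := h
  have hL1 : 1 ≤ L := le_trans one_le_two hL
  have hρ : 1 ≤ c.ρ := le_trans hL1 c.L_le_ρ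
  have hk : c.sq c.k = cube L c.a c.M c.ρ c.k c.k := cubeFam_false_of_le L c.a c.M c.ρ le_rfl
  -- two distinct directions (`d ≥ 2`), to name a plaquette through a bond
  have hdir : ∀ κ : Fin d, ∃ τ : Fin d, τ ≠ κ := fun κ => by
    by_cases h0 : (κ : ℕ) = 0
    · exact ⟨⟨1, by omega⟩, fun h => by have := congrArg Fin.val h; simp [h0] at this⟩
    · exact ⟨⟨0, by omega⟩, fun h => h0 (by have := congrArg Fin.val h; simpa using this.symm)⟩
  -- geometry: the bonds starting in `Q` have both ends in `□_k ⊆ □̃`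
  have hmemk : ∀ z ∈ Q, z ∈ c.sq c.k := fun z hz => by
    rw [hk]; exact box_subset_cube_top L c.a c.M c.ρ c.k (hQ hz)
  have hmemk' : ∀ z ∈ Q, ∀ κ : Fin d, z + e κ ∈ c.sq c.k := fun z hz κ => by
    rw [hk]; exact add_e_mem_cube_top hL1 hρ (hQ hz) κ
  have hside : ∀ z ∈ Q, ∀ ν : Fin d, SideTouches (c.sq c.k) z ν := fun z hz ν => by
    obtain ⟨τ, hτ⟩ := hdir ν
    exact sideTouches_of_bondTouches hτ (Or.inl (hmemk z hz))
  have hside' : ∀ z ∈ Q, ∀ κ ν : Fin d, SideTouches (c.sq c.k) (z + e κ) ν := fun z hz κ ν => by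
    obtain ⟨τ, hτ⟩ := hdir ν
    exact sideTouches_of_bondTouches hτ (Or.inl (hmemk' z hz κ))
  have htil : ∀ z ∈ Q, InBox (tlo L (tLo c.a c.ρ) c.k) (thi L (tHi c.a c.M c.ρ) c.k) z := fun z hz => by
    have h1 : z ∈ cube L c.a c.M c.ρ c.k c.k := by simpa only [hk] using hmemk z hz
    exact cube_subset_tcube hL hρ le_rfl h1
  have htil' : ∀ z ∈ Q, ∀ κ : Fin d, InBox (tlo L (tLo c.a c.ρ) c.k) (thi L (tHi c.a c.M c.ρ) c.k) (z + e κ) :=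
    fun z hz κ => by
    have h1 : z + e κ ∈ cube L c.a c.M c.ρ c.k c.k := by simpa only [hk] using hmemk' z hz κ
    exact cube_subset_tcube hL hρ le_rfl h1
  -- scale letters
  have hξ : scaleLen (L : ℝ) η c.k = (L : ℝ) ^ c.k * η := rfl
  have hspos : 0 < (L : ℝ) ^ c.k * η := by positivity
  have hIη : (I * η : ℂ) ≠ 0 := mul_ne_zero Complex.I_ne_zero (by exact_mod_cast hη.ne')
  have hnη : ‖((η : ℂ)⁻¹)‖ = η⁻¹ := by
    rw [norm_inv, Complex.norm_real, Real.norm_eq_abs, abs_of_pos hη]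
  -- the gauge `(v⁻¹u′)⁻¹` and the field `A = (1/iη) log U₁`
  refine ⟨fun x => (((c.vfix U₀)⁻¹ * u) x)⁻¹, fun κ z => logCfg η (c.fixed U₀ u) z κ, ?_, ?_, ?_, ?_⟩
  · -- unit type
    intro z _
    have h1 : (((c.vfix U₀)⁻¹ * u) z)⁻¹ ∈ U1 𝔸 := unitaryUnits_le_U1 ((unitaryUnits 𝔸).inv_mem (hw z))
    exact ⟨h1.1, h1.2⟩
  · -- `U₀^u = e^{iηA}` on the bonds of `Q`
    intro κ z hz
    have hag : gaugeAct (fun x => (((c.vfix U₀)⁻¹ * u) x)⁻¹) U₀ z κ = c.fixed U₀ u z κ := h135 z κ (htil z hz) (htil' z hz κ)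
    have hexp := (h162 c.k le_rfl ⟨z, κ⟩ (hside z hz κ)).1
    rw [gaugeTr_byDir, byDir_apply, hag, hexp]
    ext
    simp only [fluct, B9Eq37Insertion.val_holU, Beta.TransportVertices.holonomy_cons, Beta.TransportVertices.holonomy_nil, mul_one,
      cfgExp, val_expUnit]
    rw [← smul_smul, Complex.coe_smul]
  · -- `|A| < C(Lᵏη)⁻¹`
    intro κ z hz
    have hb := (h162 c.k le_rfl ⟨z, κ⟩ (hside z hz κ)).2.2
    rw [hξ]
    calc ‖logCfg η (c.fixed U₀ u) z κ‖ ≤ r * ((L : ℝ) ^ c.k * η)⁻¹ := hb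
      _ < C * ((L : ℝ) ^ c.k * η)⁻¹ := mul_lt_mul_of_pos_right hrC (inv_pos.mpr hspos)
  · -- `|∇^ηA| < C(Lᵏη)⁻²`: the `j = k` member of the `msup (−2)` clause, read pointwise on a bounded family
    intro κ ν z hz
    have hB := bdd_sideTouches_cubeFam L c.a c.M c.ρ c.k η (-(2 : ℝ))
      (fun t : Fin d × Fin d × B7Prop1Explicit.Site d => covDerivFwd η (1 : B7Prop1Explicit.Site d → Fin d → 𝔸ˣ) t.1 (fun w => c.expo η U₀ u w t.2.1) t.2.2)
    have hpt := norm_le_of_msup_le hL1 hη hB h136₂ (j := c.k) le_rfl (i := (κ, ν, z)) (hside z hz ν)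
    have he1 : c.expo η U₀ u z ν = logCfg η (c.fixed U₀ u) z ν := mlogCfg_of_sideTouches η _ le_rfl (hside z hz ν)
    have he2 : c.expo η U₀ u (z + e κ) ν = logCfg η (c.fixed U₀ u) (z + e κ) ν := mlogCfg_of_sideTouches η _ le_rfl (hside' z hz κ ν)
    have hcd : covDerivFwd η (1 : B7Prop1Explicit.Site d → Fin d → 𝔸ˣ) κ (fun w => c.expo η U₀ u w ν) z =
        η⁻¹ • (logCfg η (c.fixed U₀ u) (z + e κ) ν - logCfg η (c.fixed U₀ u) z ν) := by
      simp only [covDerivFwd, he1, he2, Pi.one_apply, conjR, Units.val_one, inv_one, one_mul, mul_one]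
    have hcov : covD (shiftT d) (fun _ _ => (1 : 𝔸ˣ)) κ (fun w => logCfg η (c.fixed U₀ u) w ν) z =
        logCfg η (c.fixed U₀ u) (z + e κ) ν - logCfg η (c.fixed U₀ u) z ν := by
      simp only [covD, R, shiftT_apply, Units.val_one, inv_one, one_mul, mul_one]
    have hrpow : ((L : ℝ) ^ c.k * η) ^ (-(2 : ℝ)) = (((L : ℝ) ^ c.k * η) ^ 2)⁻¹ := by
      rw [Real.rpow_neg hspos.le, Real.rpow_two]
    have h1 : η⁻¹ * ‖logCfg η (c.fixed U₀ u) (z + e κ) ν - logCfg η (c.fixed U₀ u) z ν‖ ≤ r * (((L : ℝ) ^ c.k * η) ^ 2)⁻¹ := by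
      have h2 := hpt
      rw [hcd, norm_smul, Real.norm_eq_abs, abs_inv, abs_of_pos hη, hrpow] at h2
      exact h2
    rw [hcov, norm_smul, hnη, hξ]
    calc η⁻¹ * ‖logCfg η (c.fixed U₀ u) (z + e κ) ν - logCfg η (c.fixed U₀ u) z ν‖ ≤ r * (((L : ℝ) ^ c.k * η) ^ 2)⁻¹ := h1
      _ < C * (((L : ℝ) ^ c.k * η) ^ 2)⁻¹ := mul_lt_mul_of_pos_right hrC (inv_pos.mpr (by positivity))

end Bridge

/-! ## §2 The index-0 cubes: (3.35) at scale `L⁰η = η` from the plaquette radius alone, in the complete axial gauge -/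

section IndexZero

variable {𝔸 : Type*} [NormedRing 𝔸] [NormedAlgebra ℂ 𝔸] [CompleteSpace 𝔸] [NormOneClass 𝔸]

/-- ★ **(3.35) AT AN INDEX-0 CUBE** (print p. 98 subsumes the case in the general one: «we have to admit the value k = 0. In this case the reasoning is much simpler and will be covered by our analysis of a general case, so we can assume that k ≥ 1»;
NODE 00's `CubeB8` carries `1 ≤ k`, so the index-0 class cubes get this seat's own elementary argument [folklore]): a `U1`-valued configuration `V`
whose plaquette variables are within `α` of `1` (the level-0 clause of `𝔄_k`, (1.7) with `j = 0`) satisfies the (3.35)-clause of [4] at scale `L⁰η = η`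
on every set `Q` of `ℓ¹`-radius `R` about a point `y`, for every `C > 4(D + 1)α`, provided `(D + 1)α ≤ ½` (any `η > 0`): in the complete axial gauge
`u = axialFn V y` of [Balaban1985Averaging] p. 24, `A := (iη)⁻¹ log V^u` has `|A| ≤ 2Rα·η⁻¹ < Cη⁻¹` (`B7Prop1Explicit.axial_bond_bound` + `‖log X‖ ≤ 2‖X − 1‖`)
and `|∇^ηA| ≤ η⁻²·2(‖V^u(b + e_κ) − 1‖ + ‖V^u(b) − 1‖) ≤ 4(D + 1)α·η⁻² < Cη⁻²` (`log` is `2`-Lipschitz on `‖· − 1‖ ≤ ½`).  The mechanism of dag-n16-b's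
`B9Eq335AxialCriterion.reg335Zd_of_plaq_radii` §6 at index `0`, the gradient radius replaced by the triangle inequality. [folklore]
[cite: Balaban1985RegularSpaces, p.98 («the value k = 0 … covered by our analysis of a general case»), (1.7) p.77, (1.33) p.82; Balaban1985BackgroundPropagators, (3.35) p.396; Balaban1985Averaging, pp.24–25] -/
theorem reg335Cube_index_zero {V : B7Prop1Explicit.Site d → Fin d → 𝔸ˣ} (hV : ∀ x κ, V x κ ∈ U1 𝔸) {η : ℝ} (hη : 0 < η) (L : ℕ)
    {α D : ℝ} (hα : 0 ≤ α) (hD : 0 ≤ D) (hsmall : (D + 1) * α ≤ 1 / 2)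
    (h44 : ∀ (x : B7Prop1Explicit.Site d) (κ μ : Fin d), κ ≠ μ → ‖((hol V x (plaqWord κ μ) : 𝔸ˣ) : 𝔸) - 1‖ ≤ α)
    {Q : Set (B7Prop1Explicit.Site d)} {y : B7Prop1Explicit.Site d} (hQ : ∀ z ∈ Q, (l1 (z - y) : ℝ) ≤ D) {C : ℝ} (hC : 4 * (D + 1) * α < C) :
    Reg335Cube (shiftT d) (byDir V) η Q (scaleLen (L : ℝ) η 0) C := by
  have hξ : scaleLen (L : ℝ) η 0 = η := by simp [scaleLen]
  have hIη : (I * η : ℂ) ≠ 0 := mul_ne_zero Complex.I_ne_zero (by exact_mod_cast hη.ne')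
  have hnIη : ‖(I * η : ℂ)⁻¹‖ = η⁻¹ := by
    rw [norm_inv, norm_mul, Complex.norm_I, one_mul, Complex.norm_real, Real.norm_eq_abs, abs_of_pos hη]
  have hnη : ‖((η : ℂ)⁻¹)‖ = η⁻¹ := by
    rw [norm_inv, Complex.norm_real, Real.norm_eq_abs, abs_of_pos hη]
  have hu : ∀ z, axialFn V y z ∈ U1 𝔸 := axialFn_mem hV y
  -- the bond bound of [Balaban1985Averaging] p. 25 at `z ∈ Q` and at `z + e_κ`
  have hb1 : ∀ z ∈ Q, ∀ κ, ‖((gaugeAct (axialFn V y) V z κ : 𝔸ˣ) : 𝔸) - 1‖ ≤ D * α := fun z hz κ =>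
    (axial_bond_bound V hV y h44 hα z κ).trans (mul_le_mul_of_nonneg_right (hQ z hz) hα)
  have hb2 : ∀ z ∈ Q, ∀ κ ν, ‖((gaugeAct (axialFn V y) V (z + e κ) ν : 𝔸ˣ) : 𝔸) - 1‖ ≤ (D + 1) * α := fun z hz κ ν => by
    refine (axial_bond_bound V hV y h44 hα (z + e κ) ν).trans (mul_le_mul_of_nonneg_right ?_ hα)
    have hl : (l1 (z + e κ - y) : ℝ) ≤ l1 (z - y) + 1 := by
      have h := l1_add_le (z - y) (e κ)
      rw [show z - y + e κ = z + e κ - y by abel, show l1 (e κ : B7Prop1Explicit.Site d) = 1 from l1_vec ((κ, true) : Letter d)] at h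
      exact_mod_cast h
    linarith [hQ z hz]
  have hRα : D * α ≤ 1 / 2 := by nlinarith
  have hb1' : ∀ z ∈ Q, ∀ κ, ‖((gaugeAct (axialFn V y) V z κ : 𝔸ˣ) : 𝔸) - 1‖ ≤ 1 / 2 := fun z hz κ => (hb1 z hz κ).trans hRα
  have hb2' : ∀ z ∈ Q, ∀ κ ν, ‖((gaugeAct (axialFn V y) V (z + e κ) ν : 𝔸ˣ) : 𝔸) - 1‖ ≤ 1 / 2 := fun z hz κ ν =>
    (hb2 z hz κ ν).trans hsmall
  refine ⟨axialFn V y, fun κ z => (I * η : ℂ)⁻¹ • mlog ((gaugeAct (axialFn V y) V z κ : 𝔸ˣ) : 𝔸), ?_, ?_, ?_, ?_⟩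
  · exact fun z _ => ⟨(hu z).1, (hu z).2⟩
  · -- `V^u = e^{iηA}` on `Q`
    intro κ z hz
    have hlt : ‖((gaugeAct (axialFn V y) V z κ : 𝔸ˣ) : 𝔸) - 1‖ < 1 := (hb1' z hz κ).trans_lt (by norm_num)
    rw [gaugeTr_byDir]
    ext
    simp only [byDir_apply, fluct, B9Eq37Insertion.val_holU, Beta.TransportVertices.holonomy_cons,
      Beta.TransportVertices.holonomy_nil, mul_one, smul_smul, mul_inv_cancel₀ hIη, one_smul]
    exact (exp_mlog hlt).symm
  · -- `|A| < Cη⁻¹`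
    intro κ z hz
    rw [norm_smul, hnIη, hξ]
    have hm : ‖mlog ((gaugeAct (axialFn V y) V z κ : 𝔸ˣ) : 𝔸)‖ ≤ 2 * (D * α) :=
      (norm_mlog_le_two_mul (hb1' z hz κ)).trans (by linarith [hb1 z hz κ])
    have h2 : 2 * (D * α) < C := by nlinarith
    calc η⁻¹ * ‖mlog ((gaugeAct (axialFn V y) V z κ : 𝔸ˣ) : 𝔸)‖ ≤ η⁻¹ * (2 * (D * α)) :=
          mul_le_mul_of_nonneg_left hm (inv_nonneg.mpr hη.le)
      _ < η⁻¹ * C := mul_lt_mul_of_pos_left h2 (inv_pos.mpr hη)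
      _ = C * η⁻¹ := mul_comm _ _
  · -- `|∇^ηA| < Cη⁻²`: the difference of the two logarithms, each bond within `(D+1)α` of `1`
    intro κ ν z hz
    have hcov : covD (shiftT d) (fun _ _ => (1 : 𝔸ˣ)) κ
          (fun w => (I * η : ℂ)⁻¹ • mlog ((gaugeAct (axialFn V y) V w ν : 𝔸ˣ) : 𝔸)) z =
        (I * η : ℂ)⁻¹ • (mlog ((gaugeAct (axialFn V y) V (z + e κ) ν : 𝔸ˣ) : 𝔸)
          - mlog ((gaugeAct (axialFn V y) V z ν : 𝔸ˣ) : 𝔸)) := by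
      simp only [covD, R, shiftT_apply, Units.val_one, inv_one, one_mul, mul_one, smul_sub]
    have hlip : ‖mlog ((gaugeAct (axialFn V y) V (z + e κ) ν : 𝔸ˣ) : 𝔸) - mlog ((gaugeAct (axialFn V y) V z ν : 𝔸ˣ) : 𝔸)‖ ≤
        2 * ‖((gaugeAct (axialFn V y) V (z + e κ) ν : 𝔸ˣ) : 𝔸) - ((gaugeAct (axialFn V y) V z ν : 𝔸ˣ) : 𝔸)‖ := by
      have h := FederbushMean.norm_mlog_sub_mlog_le (ρ := 1 / 2) (by norm_num) (hb2' z hz κ ν) (hb1' z hz ν)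
      norm_num at h
      exact h
    have htri : ‖((gaugeAct (axialFn V y) V (z + e κ) ν : 𝔸ˣ) : 𝔸) - ((gaugeAct (axialFn V y) V z ν : 𝔸ˣ) : 𝔸)‖ ≤
        (D + 1) * α + D * α := by
      have h := norm_sub_le (((gaugeAct (axialFn V y) V (z + e κ) ν : 𝔸ˣ) : 𝔸) - 1) (((gaugeAct (axialFn V y) V z ν : 𝔸ˣ) : 𝔸) - 1)
      rw [sub_sub_sub_cancel_right] at h
      exact h.trans (add_le_add (hb2 z hz κ ν) (hb1 z hz ν))
    have hKC : 2 * ((D + 1) * α + D * α) < C := by nlinarith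
    dsimp only
    rw [hcov, norm_smul, norm_smul, hnη, hnIη, hξ]
    have hηi : 0 ≤ η⁻¹ := inv_nonneg.mpr hη.le
    calc η⁻¹ * (η⁻¹ * ‖mlog ((gaugeAct (axialFn V y) V (z + e κ) ν : 𝔸ˣ) : 𝔸) - mlog ((gaugeAct (axialFn V y) V z ν : 𝔸ˣ) : 𝔸)‖)
        ≤ η⁻¹ * (η⁻¹ * (2 * ((D + 1) * α + D * α))) := by
          gcongr
          exact hlip.trans (by linarith)
      _ < η⁻¹ * (η⁻¹ * C) := by gcongr
      _ = C * (η ^ 2)⁻¹ := by rw [sq, mul_inv]; ring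

end IndexZero

end Literature.MathematicalPhysics.QuantumFieldTheory.Balaban1983to89.B8Prop6Reg335Cube

end
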